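/- Free lead seat `ym-line-cbag-p1` (prover-ym-line-cbag-p1-g20-0; own crux `BoxFloorAllGroups` stmt-QuantumFields-22254 CLOSED) on the
planner-of-record's LINE 5, route `HankelDensitySplitting`: REGISTERED STUB 2 `stub_hankelNearUpper : HankelNearUpper` of the birth skeleton of crux
`HankelDensityFloor` (stmt-QuantumFields-26618).  RECORD-type material (node `LatticeNonFreezing`); the Yang–Mills mass gap is NOT proved by anything
here, and the crux stays open (doors 1 and 3). -/
import Summits.QuantumFields.YangMills.Theorems.HankelDensitySplittingHankelDensityFloorDefs
import Summits.QuantumFields.YangMills.Theorems.DirichletWindowLocalGaussianity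
import Literature.MathematicalPhysics.QuantumFieldTheory.LatticeGaugeStaticPotentialProofs
import Literature.MathematicalPhysics.QuantumFieldTheory.WilsonAxisSymmetry
import Literature.MathematicalPhysics.QuantumFieldTheory.LatticeGaugeProofs
import Literature.Barriers.QuantumFields.AbelianDeconfinementD4Proofs

/-!
# Route `HankelDensitySplitting`, crux `HankelDensityFloor` (stmt-QuantumFields-26618): stub 2 `HankelNearUpper`

`HankelNearUpper`: for every compact simple `G` and faithful unitary `r` there are `B, β₁ > 0` with `F_μ(1) ≤ B/β²` for all `β ≥ β₁` and all
`μ ∈ infiniteVolumeLimitPoints r.ρ β`, where `F_μ(1) = t_μ(1) + g_μ(0)` (`hF r.ρ μ 1`) is a sum of `4³ + 4⁴` guarded plaquette-pair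
covariances `plaquetteCorr r.ρ μ 0 i j x k l`.

Proof.
* The landed variance ceiling `plaquetteVarianceUpper_proof` (route `DirichletWindow`, item 8939): `Var_μ(Re tr r.ρ(U_{(0;0,1)})) =
  plaquetteCorrFn r.ρ μ 0 ≤ B/β²` for `β ≥ β₁`, all limit states `μ`.
* Transport to every site and plane (`var_plaquetteObs_le_of_forall`): the set of limit states is closed under lattice translations
  (`map_configShift_mem_infiniteVolumeLimitPoints`) and under permutations of the coordinate axes
  (`map_configPermZd_mem_infiniteVolumeLimitPoints`), and `Var_{(θ_{-y})_* μ ∘ π}(O_{(0;0,1)}) = Var_μ(O_{(y;k,l)})` for a permutation with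
  `π⁻¹ 0 = k`, `π⁻¹ 1 = l` (`exists_perm_symm_eq`).
* `2 Cov(X,Y) ≤ Var X + Var Y` (`cov_le_half_var_add`, from `Var(X − Y) ≥ 0`), so every pair covariance is `≤ B⁺/β²` (`B⁺ = max B 0`), and the
  `64 + 256` guarded terms of `F_μ(1)` give `F_μ(1) ≤ 320 B⁺/β²`.

Bookkeeping on top of the landed variance ceiling; NOT the Yang–Mills mass gap; the crux `HankelDensityFloor` is not proved here.
-/

set_option autoImplicit false

noncomputable section

open MeasureTheory ProbabilityTheory
open Literature.MathematicalPhysics.QuantumLattice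
open Literature.MathematicalPhysics.QuantumFieldTheory

namespace Summit.QuantumFields.YangMills.Theorems.HankelDensitySplitting

/-! ### `2 Cov ≤ Var + Var` -/

/-- **AM–GM for covariances.** For square-integrable `X, Y` on a probability space,
`E[XY] − E[X]E[Y] ≤ ((E[X·X] − E[X]E[X]) + (E[Y·Y] − E[Y]E[Y]))/2` (from `Var(X − Y) ≥ 0`). [folklore] -/
theorem cov_le_half_var_add {Ω : Type*} [MeasurableSpace Ω] (μ : Measure Ω) [IsProbabilityMeasure μ] {X Y : Ω → ℝ}
    (hX : MemLp X 2 μ) (hY : MemLp Y 2 μ) :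
    (∫ ω, X ω * Y ω ∂μ) - (∫ ω, X ω ∂μ) * (∫ ω, Y ω ∂μ) ≤
      (((∫ ω, X ω * X ω ∂μ) - (∫ ω, X ω ∂μ) * (∫ ω, X ω ∂μ)) +
        ((∫ ω, Y ω * Y ω ∂μ) - (∫ ω, Y ω ∂μ) * (∫ ω, Y ω ∂μ))) / 2 := by
  have hc : cov[X, Y; μ] = (∫ ω, X ω * Y ω ∂μ) - (∫ ω, X ω ∂μ) * (∫ ω, Y ω ∂μ) := by
    rw [covariance_eq_sub hX hY]; rfl
  have hvX : Var[X; μ] = (∫ ω, X ω * X ω ∂μ) - (∫ ω, X ω ∂μ) * (∫ ω, X ω ∂μ) := by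
    rw [← covariance_self hX.aestronglyMeasurable.aemeasurable, covariance_eq_sub hX hX]; rfl
  have hvY : Var[Y; μ] = (∫ ω, Y ω * Y ω ∂μ) - (∫ ω, Y ω ∂μ) * (∫ ω, Y ω ∂μ) := by
    rw [← covariance_self hY.aestronglyMeasurable.aemeasurable, covariance_eq_sub hY hY]; rfl
  have hsub := variance_sub hX hY
  have hnn := variance_nonneg (X - Y) μ
  rw [← hc, ← hvX, ← hvY]
  linarith

/-! ### Variances of all plaquettes of a limit state -/

section Lattice

variable {N : ℕ} {G : Type} [Group G] [TopologicalSpace G] [IsTopologicalGroup G] [CompactSpace G]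
  [MeasurableSpace G] [BorelSpace G]

/-- For `k < l` in `Fin 4` there is a permutation of the axes with `π⁻¹ 0 = k`, `π⁻¹ 1 = l`. [folklore] -/
theorem exists_perm_symm_eq (k l : Fin 4) (hkl : k < l) :
    ∃ π : Equiv.Perm (Fin 4), π.symm 0 = k ∧ π.symm 1 = l := by
  have hl0 : l ≠ 0 := fun h => by subst h; exact absurd hkl (Fin.not_lt_zero k)
  have hlk : l ≠ k := fun h => by subst h; exact lt_irrefl _ hkl
  have h01 : (0 : Fin 4) ≠ 1 := by decide
  refine ⟨(Equiv.swap 0 k * Equiv.swap 1 l).symm, ?_, ?_⟩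
  · rw [Equiv.symm_symm, Equiv.Perm.mul_apply, Equiv.swap_apply_of_ne_of_ne h01 hl0.symm, Equiv.swap_apply_left]
  · rw [Equiv.symm_symm, Equiv.Perm.mul_apply, Equiv.swap_apply_left, Equiv.swap_apply_of_ne_of_ne hl0 hlk]

/-- **Every plaquette variance of a limit state is bounded by the sup of the `(0;0,1)`-variances over the limit states.**  If
`plaquetteCorrFn ρ ν 0 = Var_ν(Re tr ρ(U_{(0;0,1)})) ≤ b` for all `ν ∈ infiniteVolumeLimitPoints ρ β`, then for every limit state `μ`, every
site `y` and plane `k < l`: `Var_μ(Re tr ρ(U_{(y;k,l)})) ≤ b` — the translate `(θ_{−y})_* μ` and its axis permutation are again limit states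
(`map_configShift_mem_infiniteVolumeLimitPoints`, `map_configPermZd_mem_infiniteVolumeLimitPoints`). [folklore] -/
theorem var_plaquetteObs_le_of_forall (ρ : G →* Matrix (Fin N) (Fin N) ℂ) (hρ : Continuous ρ) {β b : ℝ}
    (hb : ∀ ν ∈ infiniteVolumeLimitPoints (d := 4) ρ β, plaquetteCorrFn ρ ν 0 ≤ b)
    {μ : Measure (LGConfig 4 G)} (hμ : μ ∈ infiniteVolumeLimitPoints (d := 4) ρ β)
    (y : Literature.Probability.LatticeModels.Site 4) {k l : Fin 4} (hkl : k < l) :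
    (∫ U, plaquetteObs ρ y k l U * plaquetteObs ρ y k l U ∂μ) -
        (∫ U, plaquetteObs ρ y k l U ∂μ) * (∫ U, plaquetteObs ρ y k l U ∂μ) ≤ b := by
  obtain ⟨π, hπ0, hπ1⟩ := exists_perm_symm_eq k l hkl
  have h1 := map_configShift_mem_infiniteVolumeLimitPoints ρ hμ (-y)
  have h2 := map_configPermZd_mem_infiniteVolumeLimitPoints ρ hρ h1 π
  have key := hb _ h2
  simp only [plaquetteCorrFn, plaquetteCorr, integral_map_equiv, plaquetteObs_configPermZd, sitePermZd_zero, hπ0, hπ1,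
    Literature.Barriers.QuantumFields.plaquetteObs_configShift, sub_neg_eq_add, zero_add] at key
  exact key

end Lattice

/-! ### Stub 2 -/

/-- **STUB 2 of the registered skeleton of crux `HankelDensityFloor` (stmt-QuantumFields-26618), proved: `HankelNearUpper`.**
`F_μ(1) ≤ 320·max(B,0)/β²` for `β ≥ max(β₁,1)` and every limit state, where `B, β₁` are the constants of the landed variance ceiling
`plaquetteVarianceUpper_proof`: each of the `4³ + 4⁴` guarded pair covariances in `F_μ(1) = t_μ(1) + g_μ(0)` is at most
`(Var + Var)/2 ≤ max(B,0)/β²` (`cov_le_half_var_add`, `var_plaquetteObs_le_of_forall`).  NOT the Yang–Mills mass gap; doors 1 and 3 of the crux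
stay open. -/
theorem stub_hankelNearUpper : HankelNearUpper := by
  intro G _ _ _ _ _ _ hG r
  obtain ⟨B, β₁, hvar⟩ := plaquetteVarianceUpper_proof G hG r
  refine ⟨320 * max B 0, max β₁ 1, lt_of_lt_of_le one_pos (le_max_right _ _), fun β hβ μ hμ => ?_⟩
  have hβ1 : β₁ ≤ β := (le_max_left _ _).trans hβ
  haveI : IsProbabilityMeasure μ := by
    obtain ⟨L, -, hp, -⟩ := hμ
    exact hp
  haveI : SecondCountableTopology G :=
    (r.continuous.isClosedEmbedding r.injective).isEmbedding.secondCountableTopology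
  set b : ℝ := max B 0 / β ^ 2 with hbdef
  have hb0 : 0 ≤ b := div_nonneg (le_max_right _ _) (sq_nonneg β)
  have hvar' : ∀ ν ∈ infiniteVolumeLimitPoints (d := 4) r.ρ β, plaquetteCorrFn r.ρ ν 0 ≤ b := fun ν hν =>
    (hvar β hβ1 ν hν).trans (div_le_div_of_nonneg_right (le_max_left _ _) (sq_nonneg β))
  -- square integrability of the plaquette observables
  have hL2 : ∀ (x : Literature.Probability.LatticeModels.Site 4) (i j : Fin 4), MemLp (plaquetteObs r.ρ x i j) 2 μ := by
    intro x i j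
    refine memLp_of_bounded (a := -(r.N : ℝ)) (b := r.N) (ae_of_all _ fun U => ?_)
      (measurable_plaquetteObs r.ρ r.continuous x i j).aestronglyMeasurable 2
    exact Set.mem_Icc.2 (abs_le.1 (abs_plaquetteObs_le_holds (G := G) r.ρ r.mem_unitary x i j U))
  -- every guarded pair covariance is at most `b`
  have hterm : ∀ (x y : Literature.Probability.LatticeModels.Site 4) (i j k l : Fin 4), i < j → k < l →
      plaquetteCorr r.ρ μ x i j y k l ≤ b := by
    intro x y i j k l hij hkl
    have h := cov_le_half_var_add μ (hL2 x i j) (hL2 y k l)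
    have v1 := var_plaquetteObs_le_of_forall r.ρ r.continuous hvar' hμ x hij
    have v2 := var_plaquetteObs_le_of_forall r.ρ r.continuous hvar' hμ y hkl
    unfold plaquetteCorr
    linarith
  have hite3 : ∀ (j k l : Fin 4),
      (if 0 < j ∧ k < l then
          plaquetteCorr r.ρ μ 0 0 j (((1 : ℕ) : ℤ) • Pi.single (0 : Fin 4) (1 : ℤ)) k l else 0) ≤ b := by
    intro j k l
    by_cases h : 0 < j ∧ k < l
    · rw [if_pos h]; exact hterm _ _ _ _ _ _ h.1 h.2
    · rw [if_neg h]; exact hb0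
  have hite4 : ∀ (i j k l : Fin 4),
      (if 0 < i ∧ i < j ∧ k < l then
          plaquetteCorr r.ρ μ 0 i j (((1 - 1 : ℕ) : ℤ) • Pi.single (0 : Fin 4) (1 : ℤ)) k l else 0) ≤ b := by
    intro i j k l
    by_cases h : 0 < i ∧ i < j ∧ k < l
    · rw [if_pos h]; exact hterm _ _ _ _ _ _ h.2.1 h.2.2
    · rw [if_neg h]; exact hb0
  have s1 : (∑ j : Fin 4, ∑ k : Fin 4, ∑ l : Fin 4,
      if 0 < j ∧ k < l then
          plaquetteCorr r.ρ μ 0 0 j (((1 : ℕ) : ℤ) • Pi.single (0 : Fin 4) (1 : ℤ)) k l else 0) ≤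
        ∑ j : Fin 4, ∑ k : Fin 4, ∑ l : Fin 4, b :=
    Finset.sum_le_sum fun j _ => Finset.sum_le_sum fun k _ => Finset.sum_le_sum fun l _ => hite3 j k l
  have s2 : (∑ i : Fin 4, ∑ j : Fin 4, ∑ k : Fin 4, ∑ l : Fin 4,
      if 0 < i ∧ i < j ∧ k < l then
          plaquetteCorr r.ρ μ 0 i j (((1 - 1 : ℕ) : ℤ) • Pi.single (0 : Fin 4) (1 : ℤ)) k l else 0) ≤
        ∑ i : Fin 4, ∑ j : Fin 4, ∑ k : Fin 4, ∑ l : Fin 4, b :=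
    Finset.sum_le_sum fun i _ => Finset.sum_le_sum fun j _ => Finset.sum_le_sum fun k _ =>
      Finset.sum_le_sum fun l _ => hite4 i j k l
  simp only [Finset.sum_const, Finset.card_univ, Fintype.card_fin, nsmul_eq_mul, Nat.cast_ofNat] at s1 s2
  have htot : hF r.ρ μ 1 ≤ 320 * b := by
    unfold hF
    linarith
  calc hF r.ρ μ 1 ≤ 320 * b := htot
    _ = 320 * max B 0 / β ^ 2 := by rw [hbdef]; ring

end Summit.QuantumFields.YangMills.Theorems.HankelDensitySplitting

end
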